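import Summits.QuantumFields.YangMills.Theorems.ColdStartUniversalityLatticeLangevinRiemannLipschitzContraction
import Summits.QuantumFields.YangMills.Theorems.ColdStartUniversalityLatticeLangevinLiebRobinsonSemigroup
import HarnessLib

/-!
# Link-wise FROBENIUS-Lipschitz observables are `√(Σ_e ℓ_e²)`-Lipschitz for Shen–Zhu–Zhu's `ρ_L`, hence their Lipschitz seminorm CONTRACTS along the
# `SU(2)` lattice Langevin dynamics: `|P_t F(Q) − P_t F(Q')| ≤ e^(−(1−12|β'|)t)·√(Σ_e ℓ_e²)·ρ_L(Q,Q')`, every `L`, `|β'| < 1/12`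

Seat `ym-line-csu-p1` (g41), route `ColdStartUniversality` of `Summits/QuantumFields/YangMills`, helper file G47 (`--supports stmt-QuantumFields-24809`).
The seat's standard observable class is the LINK-LIPSCHITZ one (`|F(y) − F(y')| ≤ ℓ_e‖y_e − y'_e‖_F` when `y, y'` differ only on the link `e`;
Poincaré / log-Sobolev / Lieb–Robinson / Hoeffding files).  Telescoping over links (`abs_sub_le_sum_linkLipschitz`), Cauchy–Schwarz and
chord ≤ arc (G41) make every such `F` `√(Σ_e ℓ_e²)`-Lipschitz for the product Riemannian distance `ρ_L`, so G44's contraction of the `ρ_L`-Lipschitz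
seminorm applies to the whole class:

* ★ `riemannLipschitz_of_linkLipschitz` — `|F(Q') − F(Q)| ≤ √(Σ_e ℓ_e²) · ρ_L(Q,Q')` for EVERY function `F` on `SU(2)^E` with a link-Lipschitz profile `ℓ`
  (no smoothness);
* ★★★ `wilson_linkLipschitz_contraction_riemann_uniform` — for `|β'| < 1/12`, every `L`, every realising kernel family, every `C⁵` cylinder `F = f∘coords`
  with link-Lipschitz profile `ℓ`, every `t ≥ 0`, `Q`, `Q'`:  `|∫F dκ_t(Q) − ∫F dκ_t(Q')| ≤ e^(−(1−12|β'|)t) · √(Σ_e ℓ_e²) · ρ_L(Q,Q')`;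
* ★★ `wilson_linkLipschitz_contraction_frob_uniform` — the same `≤ e^(−(1−12|β'|)t) · √(Σ_e ℓ_e²) · (π/2) · √(Σ_e ‖Q'_e − Q_e‖_F²)`: Frobenius in,
  Frobenius out, universal factor `π/2` — the dependence on the initial condition of the expectation of ANY link-Lipschitz cylinder observable is
  forgotten at the volume-independent rate `1 − 12|β'|`, linearly in the initial distance (compare the Lieb–Robinson files, where the link profile
  of `κ_t F` is propagated with growth factors).

THEOREMS ONLY, no definition, no sorry.  HONEST FRAMING: fixed cut-off, strong-coupling window `|β'| < 1/12`; nothing `K`-uniform along the route's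
scaling; `UniformColdStartMixing` (24809, ASIDE) not restated; no crux, rung or summit statement is proved; the Yang–Mills mass gap is NOT proved.

References: H. Shen, R. Zhu, X. Zhu, CMP 400 (2023) 805–851, Thm 4.2 (4.5), Cor. 4.4 [ShenZhuZhu2022]; D. Bakry, I. Gentil, M. Ledoux, Grundlehren
348 (2014), Thm 3.3.18 [BakryGentilLedoux2014].
-/

set_option autoImplicit false

noncomputable section

namespace Summit.QuantumFields.YangMills.Theorems.ColdStartUniversality

open MeasureTheory ProbabilityTheory Matrix Complex Finset Filter Topology Set
open scoped ComplexConjugate BigOperators Real NNReal ENNReal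
open Literature.MathematicalPhysics.QuantumFieldTheory
open Literature.MathematicalPhysics.QuantumLattice (fundamentalRep fundamentalLatticeRep continuous_fundamentalRep fundamentalRep_apply fundamentalLatticeRep_N)

variable {L : ℕ} [NeZero L]

/-! ## §1. Link-Lipschitz ⇒ `ρ_L`-Lipschitz -/

/-- ★ **A link-Lipschitz function is `√(Σ_e ℓ_e²)`-Lipschitz for `ρ_L`.**  If `|F(y) − F(y')| ≤ ℓ_e‖y_e − y'_e‖_F` whenever `y, y'` agree off the link
`e` (all `e`; no sign condition on `ℓ` is needed), then `|F(Q') − F(Q)| ≤ √(Σ_e ℓ_e²) · ρ_L(Q,Q')` for ALL `Q, Q' ∈ SU(2)^E` (telescoping, Cauchy–Schwarz, chord ≤ arc).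
[cite: ShenZhuZhu2022, §4.1] -/
theorem riemannLipschitz_of_linkLipschitz {F : GaugeConfig 3 L (Matrix.specialUnitaryGroup (Fin 2) ℂ) → ℝ} {ℓ : Edge 3 L → ℝ}
    (hF : ∀ (e : Edge 3 L) (y y' : GaugeConfig 3 L (Matrix.specialUnitaryGroup (Fin 2) ℂ)), (∀ f, f ≠ e → y f = y' f) →
      |F y - F y'| ≤ ℓ e * frobNorm ((y e : Matrix (Fin 2) (Fin 2) ℂ) - (y' e : Matrix (Fin 2) (Fin 2) ℂ)))
    (Q Q' : GaugeConfig 3 L (Matrix.specialUnitaryGroup (Fin 2) ℂ)) :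
    |F Q' - F Q| ≤ Real.sqrt (∑ e : Edge 3 L, ℓ e ^ 2) * Real.sqrt (torusRiemannDistSq (fundamentalLatticeRep 2) Q Q') := by
  have htel := LiebRobinson.abs_sub_le_sum_linkLipschitz ℓ hF Q' Q
  -- Cauchy–Schwarz over the links
  have hCS := Finset.sum_mul_sq_le_sq_mul_sq Finset.univ ℓ (fun e => frobNorm ((Q' e : Matrix (Fin 2) (Fin 2) ℂ) - (Q e : Matrix (Fin 2) (Fin 2) ℂ)))
  have hchord : ∑ e : Edge 3 L, frobNorm ((Q' e : Matrix (Fin 2) (Fin 2) ℂ) - (Q e : Matrix (Fin 2) (Fin 2) ℂ)) ^ 2 ≤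
      torusRiemannDistSq (fundamentalLatticeRep 2) Q Q' := by
    refine le_trans (le_of_eq ?_) (sum_hsForm_sub_le_torusRiemannDistSq_two Q Q')
    refine Finset.sum_congr rfl fun e _ => ?_
    rw [frobNorm_eq_sqrt_hsForm, Real.sq_sqrt (hsForm_self_nonneg _)]
  have h0 : 0 ≤ ∑ e : Edge 3 L, ℓ e ^ 2 := Finset.sum_nonneg fun e _ => sq_nonneg _
  have hsq : (∑ e : Edge 3 L, ℓ e * frobNorm ((Q' e : Matrix (Fin 2) (Fin 2) ℂ) - (Q e : Matrix (Fin 2) (Fin 2) ℂ))) ^ 2 ≤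
      (∑ e : Edge 3 L, ℓ e ^ 2) * torusRiemannDistSq (fundamentalLatticeRep 2) Q Q' :=
    hCS.trans (mul_le_mul_of_nonneg_left hchord h0)
  calc |F Q' - F Q| ≤ ∑ e : Edge 3 L, ℓ e * frobNorm ((Q' e : Matrix (Fin 2) (Fin 2) ℂ) - (Q e : Matrix (Fin 2) (Fin 2) ℂ)) := htel
    _ ≤ |∑ e : Edge 3 L, ℓ e * frobNorm ((Q' e : Matrix (Fin 2) (Fin 2) ℂ) - (Q e : Matrix (Fin 2) (Fin 2) ℂ))| := le_abs_self _
    _ ≤ Real.sqrt ((∑ e : Edge 3 L, ℓ e ^ 2) * torusRiemannDistSq (fundamentalLatticeRep 2) Q Q') := Real.abs_le_sqrt hsq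
    _ = Real.sqrt (∑ e : Edge 3 L, ℓ e ^ 2) * Real.sqrt (torusRiemannDistSq (fundamentalLatticeRep 2) Q Q') := Real.sqrt_mul h0 _

/-! ## §2. Contraction of link-Lipschitz cylinder observables -/

/-- ★★★ **Link-Lipschitz in, `ρ_L`-Lipschitz out, contracted**: at `|β'| < 1/12`, for every torus size `L`, every realising Markov kernel family `κ`
of the `SU(2)` lattice Langevin dynamics, every `C⁵` cylinder function `F = f∘coords` with link-Lipschitz profile `ℓ` on `SU(2)^E`, every `t ≥ 0`,
`Q`, `Q'`:  `|∫ F dκ_t(Q) − ∫ F dκ_t(Q')| ≤ e^(−(1−12|β'|)t) · √(Σ_e ℓ_e²) · ρ_L(Q,Q')`.  The Yang–Mills mass gap is NOT proved.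
[cite: ShenZhuZhu2022, Theorem 4.2 (4.5)] -/
theorem wilson_linkLipschitz_contraction_riemann_uniform (L : ℕ) [NeZero L] (Q Q' : GaugeConfig 3 L (Matrix.specialUnitaryGroup (Fin 2) ℂ)) (t : ℝ≥0)
    {ℓ : Edge 3 L → ℝ} (β' : ℝ) (hβ : |β'| < 1 / 12)
    (κ : ℝ≥0 → Kernel (GaugeConfig 3 L (Matrix.specialUnitaryGroup (Fin 2) ℂ))
      (GaugeConfig 3 L (Matrix.specialUnitaryGroup (Fin 2) ℂ))) [∀ t, IsMarkovKernel (κ t)]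
    (hreal : ∀ (t : ℝ≥0) (x : GaugeConfig 3 L (Matrix.specialUnitaryGroup (Fin 2) ℂ))
        (Ω : Type) [MeasurableSpace Ω] (P : Measure Ω) [IsProbabilityMeasure P]
        (W : ℝ≥0 → Ω → (Edge 3 L × NoiseIdx 2 → ℝ)) (hW : IsFlatBrownian W P)
        (U : ℝ≥0 → Ω → GaugeConfig 3 L (Matrix.specialUnitaryGroup (Fin 2) ℂ)),
        (∀ ω, U 0 ω = x) →
        (latticeLangevinDynamics (fundamentalLatticeRep 2) β').IsSolution (fundamentalRep (Fin 2))
          hW.natFiltration P W U →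
        κ t x = P.map (U t))
    {f : (Edge 3 L × Fin 2 × Fin 2 × Bool → ℝ) → ℝ} (hf : ContDiff ℝ 5 f) :
    let coords : GaugeConfig 3 L (Matrix.specialUnitaryGroup (Fin 2) ℂ) → (Edge 3 L × Fin 2 × Fin 2 × Bool → ℝ) :=
      fun V q => (fun z : ℂ => if q.2.2.2 then z.im else z.re)
        ((fundamentalRep (Fin 2) (V q.1) : Matrix (Fin 2) (Fin 2) ℂ) q.2.1 q.2.2.1)
    (∀ (e : Edge 3 L) (y y' : GaugeConfig 3 L (Matrix.specialUnitaryGroup (Fin 2) ℂ)), (∀ f, f ≠ e → y f = y' f) →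
      |f (coords y) - f (coords y')| ≤ ℓ e * frobNorm ((y e : Matrix (Fin 2) (Fin 2) ℂ) - (y' e : Matrix (Fin 2) (Fin 2) ℂ))) →
      |∫ y, f (coords y) ∂(κ t Q) - ∫ y, f (coords y) ∂(κ t Q')| ≤
        Real.exp (-((1 - 12 * |β'|) * (t : ℝ))) * Real.sqrt (∑ e : Edge 3 L, ℓ e ^ 2) * Real.sqrt (torusRiemannDistSq (fundamentalLatticeRep 2) Q Q') := by
  intro coords hLip
  have hRL := riemannLipschitz_of_linkLipschitz (F := fun V => f (coords V)) hLip
  exact wilson_riemannLipschitz_contraction_uniform L Q Q' t (Real.sqrt_nonneg _) β' hβ κ hreal hf hRL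

/-- ★★ **Frobenius in, Frobenius out**: under the same hypotheses,
`|∫ F dκ_t(Q) − ∫ F dκ_t(Q')| ≤ e^(−(1−12|β'|)t) · √(Σ_e ℓ_e²) · (π/2) · √(Σ_e ‖Q'_e − Q_e‖_F²)` (`ρ_L ≤ (π/2)·chord`, G41).
The Yang–Mills mass gap is NOT proved. [cite: ShenZhuZhu2022, Theorem 4.2 (4.5)] -/
theorem wilson_linkLipschitz_contraction_frob_uniform (L : ℕ) [NeZero L] (Q Q' : GaugeConfig 3 L (Matrix.specialUnitaryGroup (Fin 2) ℂ)) (t : ℝ≥0)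
    {ℓ : Edge 3 L → ℝ} (β' : ℝ) (hβ : |β'| < 1 / 12)
    (κ : ℝ≥0 → Kernel (GaugeConfig 3 L (Matrix.specialUnitaryGroup (Fin 2) ℂ))
      (GaugeConfig 3 L (Matrix.specialUnitaryGroup (Fin 2) ℂ))) [∀ t, IsMarkovKernel (κ t)]
    (hreal : ∀ (t : ℝ≥0) (x : GaugeConfig 3 L (Matrix.specialUnitaryGroup (Fin 2) ℂ))
        (Ω : Type) [MeasurableSpace Ω] (P : Measure Ω) [IsProbabilityMeasure P]
        (W : ℝ≥0 → Ω → (Edge 3 L × NoiseIdx 2 → ℝ)) (hW : IsFlatBrownian W P)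
        (U : ℝ≥0 → Ω → GaugeConfig 3 L (Matrix.specialUnitaryGroup (Fin 2) ℂ)),
        (∀ ω, U 0 ω = x) →
        (latticeLangevinDynamics (fundamentalLatticeRep 2) β').IsSolution (fundamentalRep (Fin 2))
          hW.natFiltration P W U →
        κ t x = P.map (U t))
    {f : (Edge 3 L × Fin 2 × Fin 2 × Bool → ℝ) → ℝ} (hf : ContDiff ℝ 5 f) :
    let coords : GaugeConfig 3 L (Matrix.specialUnitaryGroup (Fin 2) ℂ) → (Edge 3 L × Fin 2 × Fin 2 × Bool → ℝ) :=
      fun V q => (fun z : ℂ => if q.2.2.2 then z.im else z.re)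
        ((fundamentalRep (Fin 2) (V q.1) : Matrix (Fin 2) (Fin 2) ℂ) q.2.1 q.2.2.1)
    (∀ (e : Edge 3 L) (y y' : GaugeConfig 3 L (Matrix.specialUnitaryGroup (Fin 2) ℂ)), (∀ f, f ≠ e → y f = y' f) →
      |f (coords y) - f (coords y')| ≤ ℓ e * frobNorm ((y e : Matrix (Fin 2) (Fin 2) ℂ) - (y' e : Matrix (Fin 2) (Fin 2) ℂ))) →
      |∫ y, f (coords y) ∂(κ t Q) - ∫ y, f (coords y) ∂(κ t Q')| ≤
        Real.exp (-((1 - 12 * |β'|) * (t : ℝ))) * Real.sqrt (∑ e : Edge 3 L, ℓ e ^ 2) * (Real.pi / 2 *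
          Real.sqrt (∑ e : Edge 3 L, hsForm 2 ((Q' e : Matrix (Fin 2) (Fin 2) ℂ) - (Q e : Matrix (Fin 2) (Fin 2) ℂ))
            ((Q' e : Matrix (Fin 2) (Fin 2) ℂ) - (Q e : Matrix (Fin 2) (Fin 2) ℂ)))) := by
  intro coords hLip
  have h := wilson_linkLipschitz_contraction_riemann_uniform L Q Q' t β' hβ κ hreal hf hLip
  refine h.trans (mul_le_mul_of_nonneg_left ?_ (by positivity))
  calc Real.sqrt (torusRiemannDistSq (fundamentalLatticeRep 2) Q Q')
      ≤ Real.sqrt (Real.pi ^ 2 / 4 * ∑ e : Edge 3 L, hsForm 2 ((Q' e : Matrix (Fin 2) (Fin 2) ℂ) - (Q e : Matrix (Fin 2) (Fin 2) ℂ))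
          ((Q' e : Matrix (Fin 2) (Fin 2) ℂ) - (Q e : Matrix (Fin 2) (Fin 2) ℂ))) := Real.sqrt_le_sqrt (torusRiemannDistSq_two_le Q Q')
    _ = Real.pi / 2 * Real.sqrt (∑ e : Edge 3 L, hsForm 2 ((Q' e : Matrix (Fin 2) (Fin 2) ℂ) - (Q e : Matrix (Fin 2) (Fin 2) ℂ))
          ((Q' e : Matrix (Fin 2) (Fin 2) ℂ) - (Q e : Matrix (Fin 2) (Fin 2) ℂ))) := by
        rw [Real.sqrt_mul (by positivity), show Real.pi ^ 2 / 4 = (Real.pi / 2) ^ 2 by ring, Real.sqrt_sq (by positivity)]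

end Summit.QuantumFields.YangMills.Theorems.ColdStartUniversality

end
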